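import Mathlib
import Literature.Analysis.FluidPDE.SelfSimilar
import Literature.Analysis.FluidPDE.AxisymmetricEuler
import Literature.Analysis.FluidPDE.AxisymmetricVorticityTransport
import Literature.Analysis.FluidPDE.TypeIAncientMild
import Literature.Analysis.FluidPDE.PineauVicolRSS
import Summits.NavierStokesRegularity.NavierStokesRegularity.Theorems.QuantisedSymmetryPolyhedralDssProfileExistsStubAncientMildOfClassicalTypeI
import Summits.NavierStokesRegularity.NavierStokesRegularity.Theorems.DssFarFieldSlavingBlowupTypeIDssProfileSmoothRepresentativeAe
import Summits.NavierStokesRegularity.NavierStokesRegularity.Theorems.DssFarFieldSlavingBlowupTypeIDssProfileClassToProfile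
import Summits.NavierStokesRegularity.NavierStokesRegularity.Theorems.DssFarFieldSlavingBlowupTypeIDssProfileTiltedIsotropy
import Summits.NavierStokesRegularity.NavierStokesRegularity.Theorems.SymmetryModuliCountSymmetricLiouvilleRotationCovariance
import HarnessLib

/-!
# Rigidly rotating («tilted RSS») states found in a plain-DSS / twisted-DSS cell — T27 of the
pub-ns-dss theory seat (LIOUVILLE-SIDE.md §8, NULL-TESTS.md n17)

HONEST FRAMING (cell pub-ns-dss): theorem-side bookkeeping for the census of the class
`Theses.FilamentSkeletonRss.RdssProfileTruncation` (H0–H6). Nothing in this file is numerical and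
nothing here proves or refutes anything about Navier–Stokes regularity; it records which census
states are members of a cell that is EMPTY BY THEOREM.

A census row at an `α = 0`-type cell (plain `c`-DSS, or `(c, R)`-DSS with a finite-order twist)
returns a time-periodic similarity profile `U(·, s)`. Null test n17 asks whether `U(·, s)` is a
RIGID ROTATION of `U(·, 0)` about some axis `n` at a constant rate: `U(s) = R_n(βs)_* U(0)`. Such a
state is a ROTATED SELF-SIMILAR (RSS) field about the axis `n` — in the tree's normal form, after
conjugating `n` to `e₃`, `V = pvAnsatz α U₀` with `U₀ = V(−1, ·)` (`eq_pvAnsatz_of_rss`). The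
census rows impose an inertial isotropy group `G` (e.g. `C_m` about `e₃`, a mirror). This file
proves:

* `rigidRotation_noncommutingIsotropy_trivial` (axis `e₃`, Oseen gauge): a Type-I ancient mild
  field which is `(λ, R_{e₃}(−2α log λ))`-rotated-DSS for EVERY `λ > 0` (`α ≠ 0`) and whose slice
  at `t = −1` is equivariant under ONE linear isometry `h` not commuting with the rotations about
  `e₃` vanishes identically — a corollary of the landed T23 `noncommutingCorotating_trivial`.
* `tiltedRigidRotation_noncommutingIsotropy_trivial`: the same about an arbitrary axis `P e₃`
  (`P` a linear isometry), by conjugation (`isRotatedDSS_conj`,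
  `isTypeIAncientMild_conj_linearIsometryEquiv`).
* `rdssClass_tiltedRigidRotation_empty`: the CLASS-LEVEL statement (hypotheses H0–H6 of the class
  plus the two structural hypotheses stated ALMOST EVERYWHERE per slice, the only form a numerical
  or a.e. object carries): no member of the class is rigidly rotating about an axis `P e₃` at a
  rate `α ≠ 0` while its slices are a.e.-equivariant under an isometry `g` that does not commute
  with the rotations about that axis.

Consequence for the census (NULL-TESTS n17): a converged `α = 0`-type state whose rigid-rotation
defect tends to zero under refinement, with fitted axis `n` and rate `≠ 0`, is converging to an
EMPTY cell whenever some imposed isotropy element does not commute with the rotations about `n`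
(every `C_m`-restricted row with `n ∦ e₃`, `m ≥ 2`; every row with a mirror whose normal is not
`n`); otherwise it is an RSS (K1) object about `n` and is re-filed there (conjugation covariance).
Rate `= 0` is the self-similar cell E1 (Tsai), handled in `…ControlsClassLevel`.
LEVEL (lead A22): profile-pointwise (first two theorems) and class (third).

References: Pineau–Vicol 2026 (arXiv:2607.09619) (1.7) for the RSS normal form `pvAnsatz`;
Koch–Nadirashvili–Seregin–Šverák, Acta Math. 203 (2009) §3–4 (Oseen-gauge representative, used via
the landed `typeI_ancient_smoothRepresentative_ae`); the landed T23 file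
`…TiltedIsotropy` (`noncommutingCorotating_trivial`).
-/

noncomputable section

set_option linter.dupNamespace false

namespace Summit.NavierStokesRegularity.NavierStokesRegularity.Theorems.RigidRotation

open MeasureTheory Set Function Literature.Analysis.FluidPDE
open Summit.NavierStokesRegularity.NavierStokesRegularity.Theorems
open Summit.NavierStokesRegularity.NavierStokesRegularity.Theorems.TiltedIsotropy


/-! ## Algebra: conjugation of a rotated-DSS structure, and the RSS normal form -/

/-- **Conjugation covariance of rotated DSS (T1).** If `u` is `(c, R)`-rotated-DSS and `P` is a
linear isometry, then `(t, x) ↦ P u(t, P⁻¹x)` is `(c, P R P⁻¹)`-rotated-DSS. [folklore] -/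
theorem isRotatedDSS_conj {c : ℝ} {R : EuclideanSpace ℝ (Fin 3) ≃ₗᵢ[ℝ] EuclideanSpace ℝ (Fin 3)} {u : ℝ → EuclideanSpace ℝ (Fin 3) → EuclideanSpace ℝ (Fin 3)}
    (h : IsRotatedDSS c R u) (P : EuclideanSpace ℝ (Fin 3) ≃ₗᵢ[ℝ] EuclideanSpace ℝ (Fin 3)) :
    IsRotatedDSS c ((P.symm.trans R).trans P) (fun t x => P (u t (P.symm x))) := by
  intro t x
  have key := h t (P.symm x)
  simp only [LinearIsometryEquiv.symm_trans, LinearIsometryEquiv.trans_apply,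
    LinearIsometryEquiv.symm_symm, map_smul, LinearIsometryEquiv.symm_apply_apply]
  rw [← key, map_smul]

/-- **RSS normal form.** A field which is `(λ, R_{e₃}(−2α log λ))`-rotated-DSS for every `λ > 0`
is, on `t < 0`, the Pineau–Vicol rotated self-similar field `pvAnsatz α U₀` of its own slice
`U₀ = V(−1, ·)`. [cite: PineauVicol2026, (1.7) (arXiv:2607.09619 p. 3)] -/
theorem eq_pvAnsatz_of_rss {α : ℝ} {V : ℝ → EuclideanSpace ℝ (Fin 3) → EuclideanSpace ℝ (Fin 3)}
    (hrss : ∀ c : ℝ, 0 < c → IsRotatedDSS c (rotZLIE (-(α * (2 * Real.log c)))) V) :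
    ∀ t < 0, ∀ x, V t x = pvAnsatz α (fun y _ => V (-1) y) t x := by
  intro t ht x
  have hnt : 0 < -t := neg_pos.mpr ht
  have hsq : 0 < Real.sqrt (-t) := Real.sqrt_pos.mpr hnt
  have hc : 0 < (Real.sqrt (-t))⁻¹ := inv_pos.mpr hsq
  have hc2 : (Real.sqrt (-t))⁻¹ ^ 2 * t = -1 := by
    rw [inv_pow, Real.sq_sqrt hnt.le]; field_simp; rw [div_self ht.ne]
  have hlog : Real.log (Real.sqrt (-t))⁻¹ = -(Real.log (-t)) / 2 := by
    rw [Real.log_inv, Real.log_sqrt hnt.le]; ring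
  have hψ : -(α * (2 * Real.log (Real.sqrt (-t))⁻¹)) = -(α * -Real.log (-t)) := by
    rw [hlog]; ring
  have h := hrss _ hc t x
  rw [hc2, hψ] at h
  have e1 : (Real.sqrt (-t))⁻¹ • (rotZLIE (-(α * -Real.log (-t)))) x =
      rotZLIE (-(α * -Real.log (-t))) ((Real.sqrt (-t))⁻¹ • x) := (map_smul _ _ _).symm
  rw [e1] at h
  simp only [rotZLIE_apply, rotZLIE_symm_apply, neg_neg] at h
  simp only [pvAnsatz]
  exact h.symm

/-! ## T27, axis `e₃` (Oseen gauge) -/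

/-- **T27 (axis `e₃`, Oseen gauge): a rigidly rotating state with a non-commuting isotropy is
trivial.** A Type-I ancient mild field, `(λ, R_{e₃}(−2α log λ))`-rotated-DSS for every `λ > 0`
with `α ≠ 0`, whose slice at `t = −1` is equivariant under a linear isometry `h` that does not
commute with the rotations about `e₃`, vanishes for all `t < 0`. Corollary of the landed T23
`noncommutingCorotating_trivial` via the normal form `eq_pvAnsatz_of_rss`. [this file]
[cite: GolubitskyStewart2002, Ch. 6 Lemma 6.3, Thm 6.4, Ex. 6.6]
[cite: KochNadirashviliSereginSverak2009, §4 and Thm 5.3 (arXiv:0709.3599)] -/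
theorem rigidRotation_noncommutingIsotropy_trivial {C₀ α : ℝ} (hα : α ≠ 0) {h : EuclideanSpace ℝ (Fin 3) ≃ₗᵢ[ℝ] EuclideanSpace ℝ (Fin 3)}
    (hh : ∃ (φ : ℝ) (y : EuclideanSpace ℝ (Fin 3)), h (rotZ φ y) ≠ rotZ φ (h y))
    {V : ℝ → EuclideanSpace ℝ (Fin 3) → EuclideanSpace ℝ (Fin 3)} (hV : IsTypeIAncientMild C₀ V) (hdec : HasTypeIDecay C₀ V)
    (hrss : ∀ c : ℝ, 0 < c → IsRotatedDSS c (rotZLIE (-(α * (2 * Real.log c)))) V)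
    (hiso : ∀ y, V (-1) (h y) = h (V (-1) y)) : ∀ t < 0, ∀ x, V t x = 0 := by
  have hans := eq_pvAnsatz_of_rss hrss
  have hU : (fun y => V (-1) y) = 0 :=
    noncommutingCorotating_trivial hα hh hV hdec (U := fun y => V (-1) y) hiso hans
  have hUy : ∀ y, V (-1) y = 0 := fun y => congrFun hU y
  have hz : ∀ θ : ℝ, rotZ θ (0 : EuclideanSpace ℝ (Fin 3)) = 0 := fun θ => by
    rw [← rotZLIE_apply]; exact map_zero _
  intro t ht x
  rw [hans t ht x]
  simp only [pvAnsatz, hUy, hz, smul_zero]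

/-! ## T27 about an arbitrary axis `P e₃` -/

/-- Type-I decay is invariant under conjugation by a linear isometry. [folklore] -/
theorem hasTypeIDecay_conj {C₀ : ℝ} {V : ℝ → EuclideanSpace ℝ (Fin 3) → EuclideanSpace ℝ (Fin 3)} (hdec : HasTypeIDecay C₀ V)
    (P : EuclideanSpace ℝ (Fin 3) ≃ₗᵢ[ℝ] EuclideanSpace ℝ (Fin 3)) : HasTypeIDecay C₀ (fun t x => P (V t (P.symm x))) := by
  intro t ht x
  have h := hdec t ht (P.symm x)
  simpa only [LinearIsometryEquiv.norm_map] using h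

/-- **T27 (axis `P e₃`): a rigidly rotating state about ANY axis with a non-commuting isotropy is
trivial.** Rotations about the axis `P e₃` are `P R_{e₃}(ψ) P⁻¹ = (P.symm.trans (rotZLIE ψ)).trans P`.
A Type-I ancient mild field that is `(λ, P R_{e₃}(−2α log λ) P⁻¹)`-rotated-DSS for every `λ > 0`
(`α ≠ 0`) and whose slice at `t = −1` is equivariant under a linear isometry `g` not commuting with
some rotation about that axis vanishes for all `t < 0`. Proof: conjugate by `P⁻¹` and apply the
axis-`e₃` case. [this file]
[cite: GolubitskyStewart2002, Ch. 6 Lemma 6.3, Thm 6.4, Ex. 6.6]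
[cite: KochNadirashviliSereginSverak2009, §4 and Thm 5.3 (arXiv:0709.3599)] -/
theorem tiltedRigidRotation_noncommutingIsotropy_trivial {C₀ α : ℝ} (hα : α ≠ 0)
    (P : EuclideanSpace ℝ (Fin 3) ≃ₗᵢ[ℝ] EuclideanSpace ℝ (Fin 3)) {g : EuclideanSpace ℝ (Fin 3) ≃ₗᵢ[ℝ] EuclideanSpace ℝ (Fin 3)}
    (hg : ∃ (φ : ℝ) (y : EuclideanSpace ℝ (Fin 3)), g (((P.symm.trans (rotZLIE φ)).trans P) y) ≠
      ((P.symm.trans (rotZLIE φ)).trans P) (g y))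
    {V : ℝ → EuclideanSpace ℝ (Fin 3) → EuclideanSpace ℝ (Fin 3)} (hV : IsTypeIAncientMild C₀ V) (hdec : HasTypeIDecay C₀ V)
    (hrss : ∀ c : ℝ, 0 < c →
      IsRotatedDSS c ((P.symm.trans (rotZLIE (-(α * (2 * Real.log c))))).trans P) V)
    (hiso : ∀ y, V (-1) (g y) = g (V (-1) y)) : ∀ t < 0, ∀ x, V t x = 0 := by
  -- conjugate by `Q = P⁻¹`: `V' t x = P⁻¹ V(t, P x)`
  set V' : ℝ → EuclideanSpace ℝ (Fin 3) → EuclideanSpace ℝ (Fin 3) := fun t x => P.symm (V t (P.symm.symm x)) with hV'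
  have hV'T : IsTypeIAncientMild C₀ V' :=
    SymmetryModuliCountSymmetricLiouville.isTypeIAncientMild_conj_linearIsometryEquiv hV P.symm
  have hdec' : HasTypeIDecay C₀ V' := hasTypeIDecay_conj hdec P.symm
  have hrss' : ∀ c : ℝ, 0 < c → IsRotatedDSS c (rotZLIE (-(α * (2 * Real.log c)))) V' := by
    intro c hc
    have h1 := isRotatedDSS_conj (hrss c hc) P.symm
    have e : (P.symm.symm.trans ((P.symm.trans (rotZLIE (-(α * (2 * Real.log c))))).trans P)).trans
        P.symm = rotZLIE (-(α * (2 * Real.log c))) := by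
      ext x
      simp only [LinearIsometryEquiv.trans_apply, LinearIsometryEquiv.symm_symm,
        LinearIsometryEquiv.symm_apply_apply]
    rw [e] at h1
    exact h1
  -- the conjugated isotropy `h = P⁻¹ g P`
  set h : EuclideanSpace ℝ (Fin 3) ≃ₗᵢ[ℝ] EuclideanSpace ℝ (Fin 3) := (P.trans g).trans P.symm with hh_def
  have hh : ∃ (φ : ℝ) (y : EuclideanSpace ℝ (Fin 3)), h (rotZ φ y) ≠ rotZ φ (h y) := by
    obtain ⟨φ, y, hne⟩ := hg
    refine ⟨φ, P.symm y, fun heq => hne ?_⟩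
    have heq' := congrArg P heq
    simp only [hh_def, LinearIsometryEquiv.trans_apply, LinearIsometryEquiv.apply_symm_apply,
      ← rotZLIE_apply] at heq'
    simpa only [LinearIsometryEquiv.trans_apply, rotZLIE_apply] using heq'
  have hiso' : ∀ y, V' (-1) (h y) = h (V' (-1) y) := by
    intro y
    simp only [hV', hh_def, LinearIsometryEquiv.trans_apply, LinearIsometryEquiv.symm_symm,
      LinearIsometryEquiv.apply_symm_apply, hiso]
  have hzero := rigidRotation_noncommutingIsotropy_trivial hα hh hV'T hdec' hrss' hiso'
  intro t ht x
  have h0 := hzero t ht (P.symm x)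
  simp only [hV', LinearIsometryEquiv.symm_symm, LinearIsometryEquiv.apply_symm_apply] at h0
  simpa using congrArg P h0

/-! ## T27 at CLASS level -/

/-- A.e. rotated-DSS structure transfers to the continuous representative (as in
`…ControlsClassLevel.isRotatedDSS_of_ae_structure`). [folklore] -/
private theorem isRotatedDSS_of_ae_structure' {c : ℝ} (hc : 0 < c) {R : EuclideanSpace ℝ (Fin 3) ≃ₗᵢ[ℝ] EuclideanSpace ℝ (Fin 3)}
    {u V : ℝ → EuclideanSpace ℝ (Fin 3) → EuclideanSpace ℝ (Fin 3)}
    (hdss : ∀ t < 0, (fun x => c • R.symm (u (c ^ 2 * t) (c • R x))) =ᵐ[volume] u t)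
    (hVc : ∀ t < 0, Continuous (V t)) (hVu : ∀ t < 0, V t =ᵐ[volume] u t)
    (hV0 : ∀ t, 0 ≤ t → ∀ x, V t x = 0) : IsRotatedDSS c R V := by
  have hc2 : 0 < c ^ 2 := by positivity
  have hq : Measure.QuasiMeasurePreserving (fun x : EuclideanSpace ℝ (Fin 3) => c • R x) volume volume :=
    (Measure.quasiMeasurePreserving_smul volume hc.ne').comp
      R.measurePreserving.quasiMeasurePreserving
  intro t x
  rcases lt_or_ge t 0 with ht | ht
  · have hct : c ^ 2 * t < 0 := mul_neg_of_pos_of_neg hc2 ht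
    have hae : (fun x => c • R.symm (V (c ^ 2 * t) (c • R x))) =ᵐ[volume] V t := by
      have h1 : ∀ᵐ x ∂(volume : Measure (EuclideanSpace ℝ (Fin 3))),
          V (c ^ 2 * t) (c • R x) = u (c ^ 2 * t) (c • R x) := hq.ae (hVu _ hct)
      filter_upwards [h1, hVu t ht, hdss t ht] with x hx hx' hx''
      rw [hx, hx'', hx']
    have hcont : Continuous fun x => c • R.symm (V (c ^ 2 * t) (c • R x)) :=
      ((R.symm.continuous.comp ((hVc _ hct).comp (R.continuous.const_smul c))).const_smul c)
    exact congrFun (Measure.eq_of_ae_eq hae hcont (hVc t ht)) x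
  · rw [hV0 t ht x, hV0 (c ^ 2 * t) (mul_nonneg hc2.le ht) (c • R x), map_zero, smul_zero]

/-- **T27 at CLASS level: the «rigidly rotating about a tilted axis» cell with a non-commuting
isotropy is EMPTY.** No member `u` of the census class — `1 < c`, ancient mild solution,
measurable slices, `(c, R)`-rotated-DSS, Type-I decay with constant `M`, not a.e. trivial — can in
addition be (i) rigidly rotating about the axis `P e₃` at a rate `α ≠ 0` — for every `λ > 0` and
every slice `t < 0`, `λ S_λ⁻¹ u(λ²t, λ S_λ x) = u(t, x)` for a.e. `x`, `S_λ = P R_{e₃}(−2α log λ) P⁻¹` —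
while (ii) its slice at `t = −1` is a.e.-equivariant under a linear isometry `g` that does not
commute with some rotation about that axis (census rows impose `g` on EVERY slice; one slice is
what the proof uses). (For `α = 0` the member would be self-similar: cell E1, `…ControlsClassLevel`.)
Non-vacuity: (i), (ii), the Type-I bound, measurability and non-triviality are jointly satisfied by
continuous NON-solutions (any `(−t)^{−1/2} P R_{e₃}(αs) U₀(R_{e₃}(−αs) P⁻¹x/√(−t))` with `U₀`
`g`-equivariant after conjugation, `‖U₀(y)‖ ≤ M/(1+‖y‖)`, not axisymmetric); the mild-solution
property is what the conclusion uses (T23: forward propagation of isotropy, then KNSS).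
Proof: smooth representative with the same constant (`typeI_ancient_smoothRepresentative_ae`),
transfer of (i) and (ii) to it (`isRotatedDSS_of_ae_structure'`, `equivariant_of_ae_equivariant`),
then `tiltedRigidRotation_noncommutingIsotropy_trivial`. [this file]
[cite: GolubitskyStewart2002, Ch. 6 Lemma 6.3, Thm 6.4, Ex. 6.6]
[cite: KochNadirashviliSereginSverak2009, §4 and Thm 5.3 (arXiv:0709.3599)] -/
theorem rdssClass_tiltedRigidRotation_empty (M : ℝ) {α : ℝ} (hα : α ≠ 0)
    (P : EuclideanSpace ℝ (Fin 3) ≃ₗᵢ[ℝ] EuclideanSpace ℝ (Fin 3)) {g : EuclideanSpace ℝ (Fin 3) ≃ₗᵢ[ℝ] EuclideanSpace ℝ (Fin 3)}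
    (hg : ∃ (φ : ℝ) (y : EuclideanSpace ℝ (Fin 3)), g (((P.symm.trans (rotZLIE φ)).trans P) y) ≠
      ((P.symm.trans (rotZLIE φ)).trans P) (g y)) :
    ¬ ∃ (c : ℝ) (R : EuclideanSpace ℝ (Fin 3) ≃ₗᵢ[ℝ] EuclideanSpace ℝ (Fin 3)) (u : ℝ → EuclideanSpace ℝ (Fin 3) → EuclideanSpace ℝ (Fin 3)),
      1 < c ∧ IsAncientMildSolution 1 u ∧ (∀ t < 0, AEStronglyMeasurable (u t) volume) ∧
      IsRotatedDSS c R u ∧ HasTypeIDecay M u ∧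
      (∀ lam : ℝ, 0 < lam → ∀ t < 0,
        (fun x => lam • ((P.symm.trans (rotZLIE (-(α * (2 * Real.log lam))))).trans P).symm
          (u (lam ^ 2 * t) (lam • ((P.symm.trans (rotZLIE (-(α * (2 * Real.log lam))))).trans P) x)))
          =ᵐ[volume] u t) ∧
      ((fun x => u (-1) (g x)) =ᵐ[volume] fun x => g (u (-1) x)) ∧
      ¬ (∀ t < 0, u t =ᵐ[volume] 0) := by
  rintro ⟨c, R, u, -, hmild, hmeas, -, hTI, hrss, hiso, hne⟩
  obtain ⟨V, hT, hdec, hVu, hV0⟩ := typeI_ancient_smoothRepresentative_ae hmild hmeas hTI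
  have hVc : ∀ t < 0, Continuous (V t) := fun t ht => slice_continuous hT ht
  have hrssV : ∀ lam : ℝ, 0 < lam →
      IsRotatedDSS lam ((P.symm.trans (rotZLIE (-(α * (2 * Real.log lam))))).trans P) V :=
    fun lam hlam => isRotatedDSS_of_ae_structure' hlam (hrss lam hlam) hVc hVu hV0
  have hisoV : ∀ y, V (-1) (g y) = g (V (-1) y) :=
    equivariant_of_ae_equivariant g (hVc (-1) (by norm_num)) (hVu (-1) (by norm_num)) hiso
  have hz := tiltedRigidRotation_noncommutingIsotropy_trivial hα P hg hT hdec hrssV hisoV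
  exact hne fun t ht =>
    (hVu t ht).symm.trans (Filter.EventuallyEq.of_eq (funext fun x => hz t ht x))

end Summit.NavierStokesRegularity.NavierStokesRegularity.Theorems.RigidRotation

end
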